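import Summits.QuantumAdvantage.QuantumAdvantage.Theorems.SupportDialResidueCertificateF

/-! # SupportDial residue certificate — part G (decomp-qadv-lens-1 g7, node «ResidueDial» rev 5)

§7c part 1: the 192-state 𝔽₂ transfer automaton, the parity-vector recursion `P_succ`, the tables and the `decide +kernel` checks (`iterP_seven`, `tab_stable`, read-outs). -/

set_option linter.dupNamespace false
set_option linter.style.longLine false
set_option linter.unusedVariables false

open Finset
open Literature.Computability.QuantumComplexity.RingHLF
open Literature.Computability.MetaComplexity.Smolensky (CubeFn mono lowDeg)
open Summit.QuantumAdvantage.AdviceFreeQNC0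

namespace Summit.QuantumAdvantage.QuantumAdvantage.Theorems.SupportDialResidueCertificate

/-! ## §7c The sign-twist law PROVED: the 𝔽₂ transfer automaton stabilises at k = 7 (rev 5)

`N_{2r+3}` is odd for every `r ≥ 1`.  The exact 192-state automaton of (kernel-walk state, `edgesIn mod 2`,
`wtAnd mod 4`, ones parity, rotation number `rot3`) has letters acting BIJECTIVELY, so its state-parity vector obeys a
one-term-per-letter recursion (`P_succ`); the vector at length 7 is an explicit table (`iterP_seven`) which two more
letters leave unchanged (`tab_stable`), hence `P (2j+7) = tab` (`P_stable`); the dictionary (`iterE_eq`, `core`,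
`signTwist_sum_eq`) identifies the sign-twist sum with the read-out of the parity vector, and the read-outs at k = 5 and
k = 7 are 1 (`readout_five`, `readout_seven`).  All finite checks are `decide +kernel` (standard axioms).  Scratch of record:
HOME/decomp-qadv-lens-1/g7/lean/S_scratch.lean (planted control `SignTwistAt 0` correctly REFUTED by `decide`). -/

section SignTwist
variable {k : ℕ}

/-- ResidueDial helper `ind_decide` (lens-1 g7 ResidueDial certificate; see the enclosing section docstring). -/
theorem ind_decide (p : Prop) [Decidable p] : ind (decide p) = if p then 1 else 0 := by
  by_cases h : p <;> simp [h]

/-! ### §7c-A The extended transfer automaton (192 states) -/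

/-- Extended state: walk state, `edgesIn mod 2`, `wtAnd mod 4`, ones parity, rotation number. -/
abbrev ES : Type := St × ZMod 2 × ZMod 4 × ZMod 2 × ZMod 3

/-- ResidueDial helper `bit4` (lens-1 g7 ResidueDial certificate; see the enclosing section docstring). -/
def bit4 (b : Bool) : ZMod 4 := if b = true then 1 else 0
/-- `(−1)^{parity}` in `ℤ/3`. -/
def sgn3 (p : ZMod 2) : ZMod 3 := if p = 0 then 1 else -1

/-- One letter of the automaton. -/
def fstep (b : Bool) (u : ES) : ES :=
  (tstep b u.1, u.2.1 + ind (decide (tstep b u.1 = (true, true))), u.2.2.1 + bit4 (b && u.1.2),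
    u.2.2.2.1 + ind b, u.2.2.2.2 + sgn3 (u.2.2.2.1 + ind b))

/-- Its inverse (each letter acts bijectively). -/
def fpred (b : Bool) (u : ES) : ES :=
  ((xor u.1.2 (b && u.1.1), u.1.1), u.2.1 - ind (decide (u.1 = (true, true))), u.2.2.1 - bit4 (b && u.1.1),
    u.2.2.2.1 - ind b, u.2.2.2.2 - sgn3 u.2.2.2.1)

set_option maxRecDepth 8000 in
/-- ResidueDial helper `fpred_fstep` (lens-1 g7 ResidueDial certificate; see the enclosing section docstring). -/
theorem fpred_fstep : ∀ (b : Bool) (u : ES), fpred b (fstep b u) = u := by decide +kernel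
set_option maxRecDepth 8000 in
/-- ResidueDial helper `fstep_fpred` (lens-1 g7 ResidueDial certificate; see the enclosing section docstring). -/
theorem fstep_fpred : ∀ (b : Bool) (u : ES), fstep b (fpred b u) = u := by decide +kernel

/-- ResidueDial helper `fstep_eq_iff` (lens-1 g7 ResidueDial certificate; see the enclosing section docstring). -/
theorem fstep_eq_iff (b : Bool) (X u : ES) : fstep b X = u ↔ X = fpred b u :=
  ⟨fun h => by rw [← h, fpred_fstep], fun h => by rw [h, fstep_fpred]⟩

/-- ResidueDial helper `initE` (lens-1 g7 ResidueDial certificate; see the enclosing section docstring). -/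
def initE (s₀ : St) : ES := (s₀, 0, 0, 0, 0)

/-- The extended fold over the first `i` letters of `β`. -/
def iterE {k : ℕ} (β : Fin k → Bool) : ℕ → ES → ES
  | 0, u => u
  | i + 1, u => if h : i < k then fstep (β ⟨i, h⟩) (iterE β i u) else iterE β i u

/-- ResidueDial helper `iterE_zero` (lens-1 g7 ResidueDial certificate; see the enclosing section docstring). -/
@[simp] theorem iterE_zero (β : Fin k → Bool) (u : ES) : iterE β 0 u = u := rfl

/-- ResidueDial helper `iterE_succ` (lens-1 g7 ResidueDial certificate; see the enclosing section docstring). -/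
theorem iterE_succ (β : Fin k → Bool) {i : ℕ} (hi : i < k) (u : ES) :
    iterE β (i + 1) u = fstep (β ⟨i, hi⟩) (iterE β i u) := by
  show (if h : i < k then _ else _) = _
  rw [dif_pos hi]

/-- **Parity vector**: number (mod 2) of words of length `k` driving `initE s₀` to `u`. -/
def P (k : ℕ) (s₀ : St) (u : ES) : ZMod 2 :=
  ∑ β : Fin k → Bool, if iterE β k (initE s₀) = u then 1 else 0

/-- ResidueDial helper `iterE_snoc_le` (lens-1 g7 ResidueDial certificate; see the enclosing section docstring). -/
theorem iterE_snoc_le (β : Fin k → Bool) (b : Bool) (u : ES) :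
    ∀ i, i ≤ k → iterE (Fin.snoc β b : Fin (k + 1) → Bool) i u = iterE β i u
  | 0, _ => rfl
  | i + 1, hi => by
    rw [iterE_succ _ (show i < k + 1 by omega), iterE_succ _ (show i < k by omega),
      iterE_snoc_le β b u i (by omega)]
    congr 1
    exact Fin.snoc_castSucc (α := fun _ => Bool) b β ⟨i, by omega⟩

/-- ResidueDial helper `iterE_snoc_last` (lens-1 g7 ResidueDial certificate; see the enclosing section docstring). -/
theorem iterE_snoc_last (β : Fin k → Bool) (b : Bool) (u : ES) :
    iterE (Fin.snoc β b : Fin (k + 1) → Bool) (k + 1) u = fstep b (iterE β k u) := by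
  rw [iterE_succ _ (Nat.lt_succ_self k), iterE_snoc_le β b u k le_rfl]
  congr 1
  exact Fin.snoc_last (α := fun _ => Bool) b β

/-- **The one-term-per-letter recursion** (letters act bijectively). -/
theorem P_succ (k : ℕ) (s₀ : St) (u : ES) :
    P (k + 1) s₀ u = P k s₀ (fpred false u) + P k s₀ (fpred true u) := by
  unfold P
  rw [← (Fin.snocEquiv fun _ => Bool).sum_comp, Fintype.sum_prod_type, Fintype.sum_bool]
  conv_lhs => rw [add_comm]
  congr 1
  · refine Finset.sum_congr rfl fun β _ => ?_
    show (if iterE (Fin.snoc β false : Fin (k + 1) → Bool) (k + 1) (initE s₀) = u then (1 : ZMod 2) else 0) = _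
    rw [iterE_snoc_last]; exact if_congr (fstep_eq_iff _ _ _) rfl rfl
  · refine Finset.sum_congr rfl fun β _ => ?_
    show (if iterE (Fin.snoc β true : Fin (k + 1) → Bool) (k + 1) (initE s₀) = u then (1 : ZMod 2) else 0) = _
    rw [iterE_snoc_last]; exact if_congr (fstep_eq_iff _ _ _) rfl rfl

/-- The recursion operator and its iterates. -/
def stepP (f : ES → ZMod 2) (u : ES) : ZMod 2 := f (fpred false u) + f (fpred true u)
/-- ResidueDial helper `iterP` (lens-1 g7 ResidueDial certificate; see the enclosing section docstring). -/
def iterP : ℕ → (ES → ZMod 2) → ES → ZMod 2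
  | 0, f => f
  | n + 1, f => stepP (iterP n f)
/-- ResidueDial helper `P0` (lens-1 g7 ResidueDial certificate; see the enclosing section docstring). -/
def P0 (s₀ : St) (u : ES) : ZMod 2 := if u = initE s₀ then 1 else 0

/-- ResidueDial helper `P_zero` (lens-1 g7 ResidueDial certificate; see the enclosing section docstring). -/
theorem P_zero (s₀ : St) : P 0 s₀ = P0 s₀ := by
  funext u
  unfold P P0
  rw [Fintype.sum_unique]
  simp only [iterE_zero]
  by_cases h : initE s₀ = u
  · rw [if_pos h, if_pos h.symm]
  · rw [if_neg h, if_neg (Ne.symm h)]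

/-- ResidueDial helper `P_eq_iterP` (lens-1 g7 ResidueDial certificate; see the enclosing section docstring). -/
theorem P_eq_iterP (s₀ : St) : ∀ k, P k s₀ = iterP k (P0 s₀)
  | 0 => P_zero s₀
  | k + 1 => by
    funext u
    rw [P_succ]
    show _ = stepP (iterP k (P0 s₀)) u
    rw [← P_eq_iterP s₀ k]
    rfl

/-- Support of the parity vector `P 7 (1, 0)` (= `P (7+2j) (1, 0)`), 20 extended states (exp/tables.py). -/
def tab10 : List ES :=
  [((false, true), 0, 2, 0, 0), ((false, true), 0, 2, 0, 2), ((false, true), 0, 2, 1, 0), ((false, true), 0, 2, 1, 1), ((true, false), 1, 0, 0, 1), ((true, false), 1, 0, 0, 2), ((true, false), 1, 0, 1, 1), ((true, false), 1, 0, 1, 2), ((true, false), 1, 2, 0, 2), ((true, false), 1, 2, 1, 1), ((true, true), 0, 1, 0, 0), ((true, true), 0, 1, 0, 1), ((true, true), 0, 1, 0, 2), ((true, true), 0, 1, 1, 0), ((true, true), 0, 1, 1, 1), ((true, true), 0, 1, 1, 2), ((true, true), 0, 3, 0, 0), ((true, true), 0, 3, 0, 2), ((true, true), 0, 3, 1,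 0), ((true, true), 0, 3, 1, 1)]
/-- Support of the parity vector `P 7 (1, 1)` (= `P (7+2j) (1, 1)`), 26 extended states (exp/tables.py). -/
def tab11 : List ES :=
  [((false, true), 1, 1, 0, 0), ((false, true), 1, 1, 0, 1), ((false, true), 1, 1, 0, 2), ((false, true), 1, 1, 1, 0), ((false, true), 1, 1, 1, 1), ((false, true), 1, 1, 1, 2), ((false, true), 1, 3, 0, 0), ((false, true), 1, 3, 0, 2), ((false, true), 1, 3, 1, 0), ((false, true), 1, 3, 1, 1), ((true, false), 0, 1, 0, 0), ((true, false), 0, 1, 1, 1), ((true, false), 0, 1, 1, 2), ((true, false), 0, 3, 0, 0), ((true, false), 0, 3, 0, 1), ((true, false), 0, 3, 1, 0), ((true, false), 0, 3, 1, 2), ((true, true), 1, 0, 0, 1), ((true, true), 1, 0, 1, 0), ((true, true), 1, 0, 1, 1), ((true, true), 1, 2, 0, 0), ((true, true), 1, 2, 0, 1), ((true, true), 1, 2, 0, 2), ((true, true), 1, 2, 1, 0), ((true, true), 1, 2, 1, 1), ((true, true), 1, 2, 1, 2)]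
/-- Support of the parity vector `P 7 (0, 1)` (= `P (7+2j) (0, 1)`), 18 extended states (exp/tables.py). -/
def tab01 : List ES :=
  [((false, true), 1, 0, 0, 1), ((false, true), 1, 0, 0, 2), ((false, true), 1, 0, 1, 0), ((false, true), 1, 0, 1, 2), ((false, true), 1, 2, 0, 2), ((false, true), 1, 2, 1, 0), ((true, false), 0, 0, 0, 0), ((true, false), 0, 0, 0, 1), ((true, false), 0, 0, 0, 2), ((true, false), 0, 0, 1, 2), ((true, false), 0, 2, 0, 1), ((true, true), 1, 1, 0, 0), ((true, true), 1, 1, 1, 0), ((true, true), 1, 1, 1, 2), ((true, true), 1, 3, 0, 0), ((true, true), 1, 3, 0, 1), ((true, true), 1, 3, 1, 1), ((true, true), 1, 3, 1, 2)]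

/-- The stabilised parity vectors as indicator tables. -/
def tab (s₀ : St) (u : ES) : ZMod 2 :=
  if s₀ = (true, false) then (if u ∈ tab10 then 1 else 0)
  else if s₀ = (true, true) then (if u ∈ tab11 then 1 else 0)
  else if s₀ = (false, true) then (if u ∈ tab01 then 1 else 0) else 0

set_option maxRecDepth 4000 in
/-- `P 7 = tab` (finite check). -/
theorem iterP_seven : ∀ s₀ : St, s₀ ≠ (false, false) → ∀ u : ES, iterP 7 (P0 s₀) u = tab s₀ u := by
  decide +kernel

set_option maxRecDepth 4000 in
/-- **Stabilisation**: two more letters do not change the parity vector (finite check). -/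
theorem tab_stable : ∀ s₀ : St, ∀ u : ES, stepP (stepP (tab s₀)) u = tab s₀ u := by
  decide +kernel

/-- Hence `P (2j+7) s₀ = tab s₀` for every `j`. -/
theorem P_stable (s₀ : St) (h : s₀ ≠ (false, false)) : ∀ j : ℕ, P (2 * j + 7) s₀ = tab s₀
  | 0 => by funext u; rw [P_eq_iterP]; exact iterP_seven s₀ h u
  | j + 1 => by
    funext u
    rw [show 2 * (j + 1) + 7 = (2 * j + 7) + 1 + 1 by ring, P_eq_iterP]
    show stepP (stepP (iterP (2 * j + 7) (P0 s₀))) u = _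
    rw [← P_eq_iterP, P_stable s₀ h j, tab_stable]

/-- Read-out functional: closed at `s₀`, odd class (ones parity 0 for odd `k`), `rot3 ≠ 0`; value = sign bit. -/
def G (s₀ : St) (u : ES) : ZMod 2 :=
  if u.1 = s₀ ∧ u.2.2.2.1 = 0 ∧ u.2.2.2.2 ≠ 0 then u.2.1 + (if u.2.2.1 = 2 then 1 else 0) else 0

/-- Sum over the three non-zero start states. -/
def Gsum (F : St → ZMod 2) : ZMod 2 := F (true, false) + F (true, true) + F (false, true)

set_option maxRecDepth 4000 in
/-- ResidueDial helper `readout_seven` (lens-1 g7 ResidueDial certificate; see the enclosing section docstring). -/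
theorem readout_seven : Gsum (fun s₀ => ∑ u : ES, G s₀ u * tab s₀ u) = 1 := by decide +kernel

set_option maxRecDepth 4000 in
/-- ResidueDial helper `readout_five` (lens-1 g7 ResidueDial certificate; see the enclosing section docstring). -/
theorem readout_five : Gsum (fun s₀ => ∑ u : ES, G s₀ u * iterP 5 (P0 s₀) u) = 1 := by decide +kernel
end SignTwist

end Summit.QuantumAdvantage.QuantumAdvantage.Theorems.SupportDialResidueCertificate
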